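import Literature.MathematicalPhysics.QuantumFieldTheory.Balaban1983to89.B4TorusPositivity
import Literature.MathematicalPhysics.QuantumFieldTheory.Balaban1983to89.B5Torus145Decay

/-!
# `Balaban1983to89.B5QGGQ145Torus` — B5 (1.45) AS AN OPERATOR IDENTITY ON THE FINITE TORUS: the matrix of
# `Q′_kG′_k²Q′_k^*` on the unit torus is the circulant whose eigenvalues are the multiplier (1.45); the printed
# positivity argument `⟨ω,Q′G′²Q′^*ω⟩ = ‖G′Q′^*ω‖² = 0 ⇒ ω = 0`; and the pv17 kernel `torusKernel145M` is the kernel of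
# `(Q′_kG′_k²Q′_k^*)^{−1}`

T. Bałaban, *Propagators and renormalization transformations for lattice gauge theories. I*, Commun. Math. Phys.
**95**, 17–40 (1984) [Balaban1984PropagatorsI] (cell paper B5): p. 25 [PDF 9], the paragraph after (1.44), and p. 26
[PDF 10], display (1.45) and the sentence after it.  Renders `1984-cmp95-propagators-rt-I-p009-x2.png`,
`1984-cmp95-propagators-rt-I-p010-x2.png` (cell folder `b2b-balaban-ref1/pages/`) read as images by this seat.

CITATION HEADER (lean-in-tree rule 2026-08-18).  PRINTED, p. 25, verbatim:
*"λ₀ = G′_k∂^*A − G′_k²Q′_k^*(Q′_kG′_k²Q′_k^*)^{−1}Q′_kG′_k∂^*A, (1.43) and for the projection operator R  R = I − G′_kQ′_k^*(Q′_kG′_k²Q′_k^*)^{−1}Q′_kG′_k. (1.44)  Now all the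
operators appearing in these formulas are well defined. We have to verify it only for (Q′_kG′_k²Q′_k^*)^{−1}. It is enough
to prove that Q′_kG′_k²Q′_k^* is positive definite. This operator is of course nonnegative and if for some ω defined on
T₁^{(k)} we have ⟨ω, Q′_kG′_k²Q′_k^*ω⟩ = ‖G′_kQ′_k^*ω‖² = 0, then Q′_k^*ω = 0, hence ω = 0. We have bounds
0 < Q′_kG′_k²Q′_k^* ≦ a^{−2}, and they imply the existence of the inverse operator and a bound from below. To understand
better the properties of this operator we calculate the Fourier transform. It is a translation invariant operator on the
unit lattice T₁^{(k)} and its Fourier transform can be written using formula (2.48) from [2]."*  P. 26, verbatim: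
*"(Q′_kG′_k²Q′_k^*)(p′) = Σ_l |u_k(p′+l)|²Δ₀²(p′)/Δ²(p′+l) · [aΣ_l |u_k(p′+l)|²Δ₀(p′)/Δ(p′+l) + Δ₀(p′)]^{−2}, p′ ∈ T₁^{(k)}.
(1.45)  From this representation and from the bounds (2.51), (2.52) of that paper, it follows that there are positive
constants γ₀, γ₁, in fact γ₀ dependent only on d, γ₁ = a^{−2}, such that γ₀ ≦ Q′_kG′_k²Q′_k^* ≦ γ₁."*  Context, p. 25
after (1.42), verbatim: *"with a > 0 (we will take eventually a = 1), and let us denote Δ′_a = Δ + aQ′_k^*Q′_k = Δ + aP′_k.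
The properties of this operator were investigated in [2], its inverse is a bounded operator G′_k"*; [2] = cell paper B4
[Balaban1983RegularityDecay], whose (2.48) (the torus momentum representation of `G_jQ_j^*`) is typed in
`B4TorusGreen244` / `B4TorusKernel`.

WHAT THE CELL ALREADY HAS (imported, untouched).  SYMBOL LEVEL (b04-g3 on the B4 → B5 edge, pv17): `B5Strip145.m145` = the display (1.45) transcribed
literally as a function of `p′`; `B5Strip145.mReg = 𝒩/E²` its regrouped form (`mReg_eq_m145`, `m145_eq_mReg_real`: equal
on the real zone off `p′ = 0`); its analytic continuation and decay (`B5Strip145Analytic/Leaves/Decay`); the finite-torus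
kernel (pv17) `B5Torus145Decay.torusKernel145M n a N x = (Π_μN_μ)⁻¹ Σ_k mReg(p′_k)⁻¹ e^{ip′_k·x}` with its volume-uniform
exponential decay `inverse145_torusKernelM_decay_torusMetric`.  OPERATOR LEVEL (b04, paper B4 on the torus): the stencil
`B4Green244.opD n a m2 = −Δ^ξ + m² + aQ^*Q` (ξ-units), the dual-grid kernel `B4TorusGreen244.KT` of B4 (2.48) with
`torusGreen244` (`D K_T(·,y) = Q^*δ^T_y`), `B4TorusPositivity.torusGreen244_unique` / `torusGreen_existsUnique` (`G = D⁻¹`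
exists uniquely on `(nN_μ)_μ`-periodic functions, `a > 0`, `m² ≥ 0`), `sum_box_fine`, `IsPeriodic.sum_box_add`.  LOCATED
GAP (cell census G-B5-34a; C-B5-8, C-adv4-34): (1.45) was certified by hand (Sherman–Morrison on the momentum fibre) and
numerically, and its INVERSE kernel's decay is kernel-checked, but the identity between the OPERATOR `Q′G′²Q′^*` built
from `G′ = D⁻¹` and the multiplier was typed nowhere (`B5Projector144` header: "(1.45) … NOT HERE").

THIS FILE (journal node QGGQ-145-TORUS-OPERATOR of the cell `pub-balaban`, unit b2b-balaban-b05-g7) closes it, sorry-free: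
* §1–§2 [folklore] conjugation on the real zone (`conj_V_mul_V`: `ū·u = |u|²`, i.e. `conj V · V = U`; `R`, `E` real) and
  character orthogonality — on the unit torus (`sum_box_mFourier_mul_conj`, dual to `MultiPeriod.sum_mFourier_grid`),
  within a block (`sum_conj_ef_mul_ef`, roots of unity), combined: the modes `e^{i(p′_k+2πl)·z}` are orthogonal over the
  fine torus (`sum_box_conj_PhZ_mul_PhZ`);
* §3 the symbol `qggqSymbol n a m2 p′ = Σ_l U_l R_l²/E²` (general `m² ≥ 0`, the square-propagator analogue of B4 (2.46))
  and **`qggqSymbol_zero_eq_mReg`** (at `m² = 0` it is `mReg` = (1.45)); Plancherel for two fibre solutions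
  (`sum_box_conj_Gfull_mul_Gfull`);
* §4 **`qggq n a m2 N y y′ := ξ^{d+1} Σ_{z∈T_ξ} \overline{K_T(z,y)} K_T(z,y′) = ⟨G′Q′^*δ_y, G′Q′^*δ_{y′}⟩_ξ`** and
  **`qggq_eq_circulant`** / **`qggq_zero_eq_circulant_mReg`**:
  `(Q′G′²Q′^*)(y,y′) = (Π_μN_μ)⁻¹ Σ_{k ∈ Π_μℤ/N_μ} mReg(p′_k) e^{ip′_k·(y−y′)}`, `p′_k = 2πk/N` — (1.45) AS AN OPERATOR
  IDENTITY on the finite torus, for every `n ≥ 1`, `N_μ ≥ 1` (and for `m² ≥ 0` with the symbol of §3);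
* §5 **`sum_box_conj_mul_opD`** (`D` is Hermitian on the torus) and **`qggq_eq_blockAvg`**: for THE periodic `ψ` with
  `Dψ = K_T(·,y′)` (`existsUnique_GGQ`), `qggq(y,y′) = ξ^{d+1}Σ_{z∈B(y)} ψ(z) = (Q′G′²Q′^*δ_{y′})(y)` — the definition IS
  the matrix of the operator product `Q′∘G′∘G′∘Q′^*`; `qggq_translate` (a kernel on `T₁`);
* §6 **`mRegr_pos`** (`mReg(p′) = 𝒩_r(p′)/E_r(p′)² > 0` on the real zone: every eigenvalue is positive), the circulant
  calculus `circ`/`circ_conv`/`circ_one`, and **`torusKernel145M_conv_qggq`** / **`qggq_conv_torusKernel145M`**: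
  `Σ_{y′∈T₁} torusKernel145M(y−y′)·(Q′G′²Q′^*)(y′,y″) = δ^{T₁}(y−y″)` and symmetrically — pv17's kernel IS the kernel of
  the operator `(Q′_kG′_k²Q′_k^*)^{−1}` of (1.43)/(1.44);
* §7 the printed positivity argument: **`gram_qggq`** (`⟨ω,Q′G′²Q′^*ω⟩ = ‖G′Q′^*ω‖²_ξ`, "of course nonnegative"),
  **`qggq_definite`** (`= 0 ⇒ ω = 0`: `D(G′Q′^*ω) = Q′^*ω`, `opD_GQ`), `mReg_at_zero` (the eigenvalue at `p′ = 0` is `a⁻²`: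
  `Q′G′²Q′^*1 = a⁻²·1`, where the printed `γ₁ = a⁻²` is attained).

DICTIONARY / HONEST SCOPE.  ξ-units of `B4Green244`/`B4TorusGreen244`: the paper's fine torus `T_η` (`η = L^{−k}`) is
`Π_μ ℤ/(nN_μ)` with `n = L^k = ξ⁻¹ ≥ 1` (functions = `(nN_μ)_μ`-periodic functions on `ℤ^{d+1}`; the paper's dimension `d`
is our `d+1`), the unit torus `T₁^{(k)}` is `Π_μ ℤ/N_μ` (period VECTOR `N`, as in b04/pv17; the paper's torus is cubic),
`Q′_k` = block average over `B(y) = {nx+j}` (`blockAvg`, weight `ξ^{d+1}`), `Q′_k^*` = block-constant extension,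
`Δ′_a = Δ + aQ′^*Q′ = opD n a 0` (`m² = 0` in the paper; §3–§5, §7 keep B4's `m² ≥ 0`, (1.45)/§6 are `m² = 0`),
`G′_k = D⁻¹` on periodic functions (`torusGreen_existsUnique`), `G′Q′^*δ_y = K_T(·,y)`; scalar fields, no gauge field
(`U = 1`); complex-valued functions (the paper's are real; conj placed on the first factor); `⟨·,·⟩` on `T₁` = `Σ_y`, on
`T_ξ` = `ξ^{d+1}Σ_z`; momenta `p′_k = 2π·rep(k/N) ∈ [−π,π]^{d+1}` (`B4TorusGreen244.dualMomentum`).  The multiplier is used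
in pv17's regrouped form `mReg` (= the literal `m145` off `p′ = 0`, where the printed quotient is `0/0` and `mReg(0) = a⁻²`
is the value).  NOT typed here: the uniform lower bound `γ₀ ≤ Q′G′²Q′^*` as an operator inequality (symbol level: pv17
`UniformStrip145`; `mRegr_pos` is pointwise), `γ₁ = a⁻²` (false for large `a`: cell census G-B5-13,
`B5.printed_gamma1_fails`), (1.43)/(1.44)/(1.46) themselves (`B5Projector144`: the projector algebra GIVEN the inverse),
the `η`-rescaling conventions, gauge-covariant `Q′_k(U)`.  Value = kernel certificate of a printed display ((1.45)) and of
the printed positivity/invertibility sentences as operator statements on the finite torus, NOT summit progress.  Staged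
byte-identically under `HOME/lean/BalabanYm4/`.

Tags: 14 `[cite: …]` (the objects `qggqSymbol`, `qggq`, `GQ` and the statements that ARE printed steps or the printed
display: `conj_V_mul_V`, `qggqSymbol_zero_eq_mReg`, `qggq_eq_circulant`, `qggq_zero_eq_circulant_mReg`,
`qggq_eq_blockAvg`, `mRegr_pos`, `torusKernel145M_conv_qggq`, `qggq_conv_torusKernel145M`, `gram_qggq`, `qggq_definite`,
`mReg_at_zero`), 36 `[folklore]` (finite Fourier algebra, periodic summation by parts, circulant calculus).  No `sorry`,
no new axioms; imports `B4TorusPositivity` (b04) and `B5Torus145Decay` (pv17) only.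
-/

namespace Literature.MathematicalPhysics.QuantumFieldTheory.Balaban1983to89.B5QGGQ145Torus

open Complex Finset ComplexConjugate UnitAddTorus
open Literature.MathematicalPhysics.QuantumFieldTheory.Balaban1983to89.B4Strip
open Literature.MathematicalPhysics.QuantumFieldTheory.Balaban1983to89.B4StripSums
open Literature.MathematicalPhysics.QuantumFieldTheory.Balaban1983to89.B4StripSumsHolder
open Literature.MathematicalPhysics.QuantumFieldTheory.Balaban1983to89.B4ContourShift
open Literature.MathematicalPhysics.QuantumFieldTheory.Balaban1983to89.B4TorusKernel
open Literature.MathematicalPhysics.QuantumFieldTheory.Balaban1983to89.B4Torus248Decay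
open Literature.MathematicalPhysics.QuantumFieldTheory.Balaban1983to89.B4Green244
open Literature.MathematicalPhysics.QuantumFieldTheory.Balaban1983to89.B4TorusGreen244
open Literature.MathematicalPhysics.QuantumFieldTheory.Balaban1983to89.B4TorusPositivity
open Literature.MathematicalPhysics.QuantumFieldTheory.Balaban1983to89.B5Strip145
open Literature.MathematicalPhysics.QuantumFieldTheory.Balaban1983to89.B5Torus145Decay
open scoped Real

noncomputable section

variable {d : ℕ}

/-! ### §1 Conjugation on the real Brillouin zone: `ū·u = |u|²`, the ratio `R` and the denominator `E` are real -/

/-- one coordinate: the conjugate of the offset phase `e^{i(x+2πj)t/n}` at a real momentum is `e^{−i(x+2πj)t/n}`. [folklore] -/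
theorem conj_ef_ofReal (n j t : ℕ) (x : ℝ) :
    conj (ef n j t (x : ℂ)) = cexp (-(I * ((x : ℂ) + 2 * π * j) * t / n)) := by
  unfold ef
  rw [← Complex.exp_conj]
  congr 1
  simp only [map_div₀, map_mul, map_add, Complex.conj_I, Complex.conj_ofReal, map_natCast, map_ofNat]
  ring

/-- one coordinate: at a real momentum the conjugate of `w_n(j;x) = e^{−i(x+2πj)/n}` is its inverse. [folklore] -/
theorem conj_w_ofReal (n j : ℕ) (x : ℝ) : conj (w n j (x : ℂ)) = (w n j (x : ℂ))⁻¹ := by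
  unfold w
  rw [← Complex.exp_conj, ← Complex.exp_neg]
  congr 1
  simp only [map_neg, map_div₀, map_mul, map_add, Complex.conj_I, Complex.conj_ofReal, map_natCast, map_ofNat]
  ring

/-- one coordinate: **at a real momentum the conjugate of the block-averaging factor `v_n(j;x)` (the continuation of
`u`'s factor) is `v̄_n(j;x) = B4Green244.vb`** (`conj e^{−i(x+2πj)s/n} = e^{i(x+2πj)s/n}`). [folklore] -/
theorem conj_v_ofReal (n j : ℕ) (x : ℝ) : conj (v n j (x : ℂ)) = vb n j x := by
  unfold v vb
  rw [map_mul, map_inv₀, map_natCast, map_sum]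
  congr 1
  refine Finset.sum_congr rfl fun s _ => ?_
  rw [map_pow, conj_w_ofReal, ef_eq_inv_w_pow]

/-- **`ū·u = |u|²` ON THE REAL ZONE, all coordinates**: `conj(V_n(l;p′)) · V_n(l;p′) = U_n(l;p′)` for `p′ ∈ [−π,π]^{m}`, `n ≥ 1`
(`B4Green244.vb_mul_v_eq_uFactor` factor by factor, including the removable point `p′_ν = l_ν = 0`).
[cite: Balaban1983RegularityDecay, (2.45)–(2.46) p.584] -/
theorem conj_V_mul_V {m : ℕ} (n : ℕ) (hn : 1 ≤ n) (l : Fin m → Fin n) (p : Fin m → ℝ) (hp : p ∈ BZ m) :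
    conj (V n l (ofRealVec p)) * V n l (ofRealVec p) = U n l (ofRealVec p) := by
  unfold V U
  rw [map_prod, ← Finset.prod_mul_distrib]
  refine Finset.prod_congr rfl fun ν _ => ?_
  show conj (v n (l ν : ℕ) ((p ν : ℝ) : ℂ)) * v n (l ν : ℕ) ((p ν : ℝ) : ℂ) = uFactor n (l ν : ℕ) ((p ν : ℝ) : ℂ)
  rw [conj_v_ofReal]
  exact vb_mul_v_eq_uFactor n (l ν) hn (l ν).isLt (p ν) (abs_le.mpr ⟨hp.1 ν, hp.2 ν⟩)

/-- the regrouped ratio `R` is real on real momenta. [folklore] -/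
theorem conj_R_ofReal {m : ℕ} (n : ℕ) [NeZero n] (m2 : ℝ) (l : Fin m → Fin n) (s : Fin m → ℝ) :
    conj (R n m2 l (ofRealVec s)) = R n m2 l (ofRealVec s) := by
  unfold R
  split_ifs
  · exact map_one _
  · rw [map_div₀, shift_ofReal, DeltaXi_ofReal, DeltaXi_ofReal, Complex.conj_ofReal, Complex.conj_ofReal]

/-- the regrouped denominator `E` is real on real momenta. [folklore] -/
theorem conj_E_ofReal {m : ℕ} (n : ℕ) [NeZero n] (a m2 : ℝ) (s : Fin m → ℝ) :
    conj (E n a m2 (ofRealVec s)) = E n a m2 (ofRealVec s) := by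
  rw [E_ofReal, Complex.conj_ofReal]

/-- the phase is odd: `p·(−x) = −p·x`. [folklore] -/
theorem phaseC_neg {m : ℕ} (P : Fin m → ℂ) (x : Fin m → ℤ) : phaseC P (-x) = -phaseC P x := by
  unfold phaseC
  simp only [Pi.neg_apply, Int.cast_neg, mul_neg, Finset.sum_neg_distrib]

/-- `e^{−ip′_k·y}` is the grid character at `−y`: `cexp(−i p′_k·y) = mFourier (−y) (k/N)`. [folklore] -/
theorem cexp_neg_phase_eq_mFourier (N : Fin (d + 1) → ℕ) (k : (i : Fin (d + 1)) → Fin (N i)) (y : Fin (d + 1) → ℤ) :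
    cexp (-(I * phaseC (ofRealVec (dualMomentum N k)) y)) = mFourier (-y) (MultiPeriod.gridPt N k) := by
  rw [mFourier_gridPt, phaseC_neg, mul_neg]

/-- `conj (mFourier (−y) t) = mFourier y t`. [folklore] -/
theorem conj_mFourier_neg {ι : Type*} [Fintype ι] (y : ι → ℤ) (t : UnitAddTorus ι) :
    conj (mFourier (-y) t) = mFourier y t := by
  rw [mFourier_neg, RingHomCompTriple.comp_apply, RingHom.id_apply]

/-! ### §2 Character orthogonality on the two tori: the unit torus `Π_μ ℤ/N_μ` and the blocks `[0,n)^{d+1}` -/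

/-- `e^{2πi a b/N}` is symmetric in the two integers. [folklore] -/
theorem fourier_swap (a b : ℤ) (N : ℕ) :
    fourier a ((((b : ℝ) / N : ℝ)) : UnitAddCircle) = fourier b ((((a : ℝ) / N : ℝ)) : UnitAddCircle) := by
  rw [fourier_coe_apply, fourier_coe_apply]
  congr 1
  push_cast
  ring

/-- a sum over the integer interval `[0,N)` is a sum over `Fin N`. [folklore] -/
theorem sum_Ico_eq_sum_fin (N : ℕ) (f : ℤ → ℂ) : ∑ t ∈ Finset.Ico (0 : ℤ) N, f t = ∑ j : Fin N, f ((j : ℕ) : ℤ) := by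
  rw [Fin.sum_univ_eq_sum_range (fun j => f ((j : ℕ) : ℤ)) N]
  refine Finset.sum_nbij' (fun t => t.toNat) (fun j => ((j : ℕ) : ℤ)) (fun t ht => ?_) (fun j hj => ?_)
    (fun t ht => ?_) (fun j _ => by simp) (fun t ht => ?_)
  · rw [Finset.mem_Ico] at ht
    rw [Finset.mem_range]
    omega
  · rw [Finset.mem_range] at hj
    rw [Finset.mem_Ico]
    omega
  · rw [Finset.mem_Ico] at ht
    exact Int.toNat_of_nonneg ht.1
  · rw [Finset.mem_Ico] at ht
    rw [Int.toNat_of_nonneg ht.1]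

/-- **ORTHOGONALITY OF THE GRID CHARACTERS OVER THE UNIT TORUS** (the dual of `MultiPeriod.sum_mFourier_grid`):
`Σ_{x ∈ Π_μ[0,N_μ)} e^{ip′_{k′}·x} \overline{e^{ip′_k·x}} = Π_μ N_μ` if `k = k′`, else `0`. [folklore] -/
theorem sum_box_mFourier_mul_conj {N : Fin (d + 1) → ℕ} (hN : ∀ i, 1 ≤ N i) (k k' : (i : Fin (d + 1)) → Fin (N i)) :
    ∑ x ∈ box N, mFourier x (MultiPeriod.gridPt N k') * conj (mFourier x (MultiPeriod.gridPt N k))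
      = if k = k' then ∏ i, ((N i : ℕ) : ℂ) else 0 := by
  classical
  have h1 : ∀ x : Fin (d + 1) → ℤ, mFourier x (MultiPeriod.gridPt N k') * conj (mFourier x (MultiPeriod.gridPt N k))
      = ∏ i, fourier (((k' i : ℕ) : ℤ) - ((k i : ℕ) : ℤ)) ((((x i : ℝ) / N i : ℝ)) : UnitAddCircle) := by
    intro x
    show (∏ i, fourier (x i) (((((k' i : ℕ) : ℝ) / N i : ℝ)) : UnitAddCircle))
        * conj (∏ i, fourier (x i) (((((k i : ℕ) : ℝ) / N i : ℝ)) : UnitAddCircle)) = _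
    rw [map_prod, ← Finset.prod_mul_distrib]
    refine Finset.prod_congr rfl fun i _ => ?_
    rw [← fourier_neg, sub_eq_add_neg, fourier_add]
    have e1 : fourier (x i) (((((k' i : ℕ) : ℝ) / N i : ℝ)) : UnitAddCircle)
        = fourier (((k' i : ℕ) : ℤ)) ((((x i : ℝ) / N i : ℝ)) : UnitAddCircle) := by
      rw [← fourier_swap]; push_cast; rfl
    have e2 : fourier (-x i) (((((k i : ℕ) : ℝ) / N i : ℝ)) : UnitAddCircle)
        = fourier (-((k i : ℕ) : ℤ)) ((((x i : ℝ) / N i : ℝ)) : UnitAddCircle) := by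
      rw [fourier_neg, fourier_neg, ← fourier_swap]; push_cast; rfl
    rw [e1, e2]
  simp_rw [h1]
  rw [show box N = Fintype.piFinset (fun i => Finset.Ico (0 : ℤ) (N i)) from rfl,
    ← Finset.prod_univ_sum (fun i => Finset.Ico (0 : ℤ) (N i))
    (fun i t => fourier (((k' i : ℕ) : ℤ) - ((k i : ℕ) : ℤ)) ((((t : ℝ) / N i : ℝ)) : UnitAddCircle))]
  have h2 : ∀ i, ∑ t ∈ Finset.Ico (0 : ℤ) (N i),
      fourier (((k' i : ℕ) : ℤ) - ((k i : ℕ) : ℤ)) ((((t : ℝ) / N i : ℝ)) : UnitAddCircle)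
      = if k i = k' i then ((N i : ℕ) : ℂ) else 0 := by
    intro i
    rw [sum_Ico_eq_sum_fin (N i) (fun t => fourier (((k' i : ℕ) : ℤ) - ((k i : ℕ) : ℤ)) ((((t : ℝ) / N i : ℝ)) : UnitAddCircle))]
    have h3 : ∑ j : Fin (N i), fourier (((k' i : ℕ) : ℤ) - ((k i : ℕ) : ℤ)) ((((((j : ℕ) : ℤ) : ℝ) / N i : ℝ)) : UnitAddCircle)
        = ∑ j : Fin (N i), fourier (((k' i : ℕ) : ℤ) - ((k i : ℕ) : ℤ)) (((((j : ℕ) : ℝ) / N i : ℝ)) : UnitAddCircle) :=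
      Finset.sum_congr rfl fun j _ => by push_cast; rfl
    rw [h3, sum_fourier_grid (hN i)]
    have hk := (k i).isLt
    have hk' := (k' i).isLt
    by_cases h : k i = k' i
    · rw [if_pos h, if_pos ⟨0, by rw [h]; ring⟩]
    · rw [if_neg h, if_neg]
      rintro ⟨c, hc⟩
      apply h
      apply Fin.ext
      have h4 : ((k' i : ℕ) : ℤ) - ((k i : ℕ) : ℤ) < N i := by omega
      have h5 : -((N i : ℕ) : ℤ) < ((k' i : ℕ) : ℤ) - ((k i : ℕ) : ℤ) := by omega
      rcases lt_trichotomy c 0 with hc0 | hc0 | hc0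
      · have : ((N i : ℕ) : ℤ) * c ≤ -((N i : ℕ) : ℤ) := by nlinarith
        omega
      · subst hc0; omega
      · have : ((N i : ℕ) : ℤ) ≤ ((N i : ℕ) : ℤ) * c := by nlinarith
        omega
  simp_rw [h2]
  by_cases h : k = k'
  · subst h
    simp
  · rw [if_neg h]
    obtain ⟨i, hi⟩ : ∃ i, k i ≠ k' i := by
      by_contra hc
      push Not at hc
      exact h (funext hc)
    exact Finset.prod_eq_zero (Finset.mem_univ i) (if_neg hi)

/-- **ORTHOGONALITY OF THE OFFSET PHASES WITHIN A BLOCK** at a common real momentum: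
`Σ_{t ∈ [0,n)^{d+1}} Π_ν \overline{e^{i(p_ν+2πl_ν)t_ν/n}} e^{i(p_ν+2πl′_ν)t_ν/n} = n^{d+1}` if `l = l′`, else `0`
(roots of unity, `B4Green244.sum_rootOfUnity_pow`; the real momentum drops out). [folklore] -/
theorem sum_conj_ef_mul_ef (n : ℕ) [NeZero n] (l l' : Fin (d + 1) → Fin n) (p : Fin (d + 1) → ℝ) :
    ∑ t : Fin (d + 1) → Fin n, ∏ ν, conj (ef n (l ν : ℕ) (t ν : ℕ) ((p ν : ℝ) : ℂ)) * ef n (l' ν : ℕ) (t ν : ℕ) ((p ν : ℝ) : ℂ)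
      = if l = l' then ((n : ℂ)) ^ (d + 1) else 0 := by
  classical
  have hn : n ≠ 0 := NeZero.ne n
  have hn' : (n : ℂ) ≠ 0 := Nat.cast_ne_zero.mpr hn
  have h := Finset.prod_univ_sum (fun _ : Fin (d + 1) => (Finset.univ : Finset (Fin n)))
    (fun ν i => conj (ef n (l ν : ℕ) (i : ℕ) ((p ν : ℝ) : ℂ)) * ef n (l' ν : ℕ) (i : ℕ) ((p ν : ℝ) : ℂ))
  rw [Fintype.piFinset_univ] at h
  rw [← h]
  have h1 : ∀ ν : Fin (d + 1), ∑ i : Fin n, conj (ef n (l ν : ℕ) (i : ℕ) ((p ν : ℝ) : ℂ)) * ef n (l' ν : ℕ) (i : ℕ) ((p ν : ℝ) : ℂ)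
      = if l ν = l' ν then (n : ℂ) else 0 := by
    intro ν
    have h2 : ∀ i : ℕ, conj (ef n (l ν : ℕ) i ((p ν : ℝ) : ℂ)) * ef n (l' ν : ℕ) i ((p ν : ℝ) : ℂ)
        = cexp (2 * π * I * (((l' ν : ℕ) : ℂ) - ((l ν : ℕ) : ℂ)) / n) ^ i := by
      intro i
      rw [conj_ef_ofReal, ef, ← Complex.exp_add, ← Complex.exp_nat_mul]
      congr 1
      field_simp
      ring
    simp_rw [h2]
    rw [Fin.sum_univ_eq_sum_range (fun i => cexp (2 * π * I * (((l' ν : ℕ) : ℂ) - ((l ν : ℕ) : ℂ)) / n) ^ i) n,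
      sum_rootOfUnity_pow n (l' ν) (l ν) hn (l' ν).isLt (l ν).isLt]
    by_cases h3 : l ν = l' ν
    · rw [if_pos h3, if_pos (by rw [h3])]
    · rw [if_neg h3, if_neg (fun h4 => h3 (Fin.ext h4))]
  simp_rw [h1]
  by_cases h3 : l = l'
  · subst h3
    simp
  · rw [if_neg h3]
    obtain ⟨ν, hν⟩ : ∃ ν, l ν ≠ l' ν := by
      by_contra hc
      push Not at hc
      exact h3 (funext hc)
    exact Finset.prod_eq_zero (Finset.mem_univ ν) (if_neg hν)

/-- combined: **orthogonality of the fine-torus momentum modes `e^{i(p′_k+2πl)·z}` over the fine torus `Π_μ ℤ/(nN_μ)`**: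
`Σ_{z ∈ Π_μ[0,nN_μ)} \overline{PhZ_l(z;p′_k)} PhZ_{l′}(z;p′_{k′}) = Π_μ N_μ · n^{d+1}` if `(k,l) = (k′,l′)`, else `0`
(block decomposition `z = nx + t`: the unit-torus sum in `x`, then the block sum in `t`). [folklore] -/
theorem sum_box_conj_PhZ_mul_PhZ (n : ℕ) [NeZero n] {N : Fin (d + 1) → ℕ} (hN : ∀ i, 1 ≤ N i)
    (k k' : (i : Fin (d + 1)) → Fin (N i)) (l l' : Fin (d + 1) → Fin n) :
    ∑ z ∈ box (fun i => n * N i), conj (PhZ n l z (ofRealVec (dualMomentum N k))) * PhZ n l' z (ofRealVec (dualMomentum N k'))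
      = if k = k' ∧ l = l' then (∏ i, ((N i : ℕ) : ℂ)) * (n : ℂ) ^ (d + 1) else 0 := by
  classical
  have hn : n ≠ 0 := NeZero.ne n
  rw [sum_box_fine]
  have h1 : ∀ (x : Fin (d + 1) → ℤ) (t : Fin (d + 1) → Fin n),
      conj (PhZ n l (finePt n x t) (ofRealVec (dualMomentum N k))) * PhZ n l' (finePt n x t) (ofRealVec (dualMomentum N k'))
      = (mFourier x (MultiPeriod.gridPt N k') * conj (mFourier x (MultiPeriod.gridPt N k)))
        * ∏ ν, conj (ef n (l ν : ℕ) (t ν : ℕ) ((dualMomentum N k ν : ℝ) : ℂ))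
            * ef n (l' ν : ℕ) (t ν : ℕ) ((dualMomentum N k' ν : ℝ) : ℂ) := by
    intro x t
    rw [PhZ_finePt n hn, PhZ_finePt n hn, map_mul, map_prod, Finset.prod_mul_distrib, ← mFourier_gridPt, ← mFourier_gridPt]
    show _ = _ * ((∏ ν, conj (ef n (l ν : ℕ) (t ν : ℕ) (ofRealVec (dualMomentum N k) ν)))
      * ∏ ν, ef n (l' ν : ℕ) (t ν : ℕ) (ofRealVec (dualMomentum N k') ν))
    ring
  simp_rw [h1, ← Finset.mul_sum, ← Finset.sum_mul, sum_box_mFourier_mul_conj hN]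
  by_cases hk : k = k'
  · subst hk
    rw [sum_conj_ef_mul_ef, if_pos rfl]
    by_cases hl : l = l'
    · rw [if_pos hl, if_pos ⟨rfl, hl⟩]
    · rw [if_neg hl, if_neg (fun h => hl h.2), mul_zero]
  · rw [if_neg hk, if_neg (fun h => hk h.1), zero_mul]

/-! ### §3 The symbol: `Σ_l |u(p′+l)|² R_l(p′)² / E(p′)²`; at `m = 0` it is the printed multiplier (1.45) -/

/-- **THE FOURIER SYMBOL OF `Q G(m²)² Q^*`** in the regrouped variables of `B4Strip` (general `m² ≥ 0`):
`Σ_{l ∈ [0,n)^m} U_n(l;p′) · R_n(m²;l;p′)² / E_n(a,m²;p′)²` — with `R_0 = 1`, `R_l = Δ^ξ_{m²}(p′)/Δ^ξ_{m²}(p′+2πl)` and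
`E = Δ^ξ_{m²}(p′)·(1 + aΣ_l |u|²/Δ^ξ_{m²}(p′+l))` this is `Σ_l |u(p′+l)|²/(Δ^ξ(p′+l)+m²)² · [1 + aΣ_l |u(p′+l)|²/(Δ^ξ(p′+l)+m²)]^{−2}`,
the square-propagator analogue of B4 (2.46); at `m² = 0` it is B5 (1.45) (`qggqSymbol_zero_eq_mReg`).
[cite: Balaban1984PropagatorsI, (1.45) p.26; Balaban1983RegularityDecay, (2.46) p.584] -/
def qggqSymbol {m : ℕ} (n : ℕ) [NeZero n] (a m2 : ℝ) (P : Fin m → ℂ) : ℂ :=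
  ∑ l : Fin m → Fin n, U n l P * R n m2 l P ^ 2 / E n a m2 P ^ 2

/-- the massless numerator regroups to `B5Strip145.Ncal`: `Σ_l U_l R_l(0)² = |u(p′)|² + Δ^ξ(p′)² Σ_{l≠0} |u(p′+l)|²/Δ^ξ(p′+l)²`
(junk-value consistent: both sides use Lean's `x/0 = 0`). [folklore] -/
theorem sum_U_mul_R_sq {m : ℕ} (n : ℕ) [NeZero n] (P : Fin m → ℂ) :
    ∑ l : Fin m → Fin n, U n l P * R n 0 l P ^ 2 = Ncal n P := by
  classical
  rw [← Finset.add_sum_erase _ _ (Finset.mem_univ (fun _ => (0 : Fin n)))]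
  unfold Ncal Xne
  congr 1
  · simp [R]
  · rw [Finset.mul_sum]
    refine Finset.sum_congr rfl fun l hl => ?_
    rw [Finset.mem_erase] at hl
    rw [R, if_neg hl.1]
    ring

/-- **AT `m² = 0` THE SYMBOL IS THE PRINTED MULTIPLIER (1.45)** in its regrouped form `B5Strip145.mReg = 𝒩/E²`
(`= m145` literally off `p′ = 0`, `B5Strip145.mReg_eq_m145` / `m145_eq_mReg_real`).
[cite: Balaban1984PropagatorsI, (1.45) p.26] -/
theorem qggqSymbol_zero_eq_mReg {m : ℕ} (n : ℕ) [NeZero n] (a : ℝ) (P : Fin m → ℂ) :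
    qggqSymbol n a 0 P = mReg n a P := by
  unfold qggqSymbol mReg
  rw [← sum_U_mul_R_sq, Finset.sum_div]

/-- the coefficient of the mode `e^{i(p′+l)·z}` in the fibre solution `Gfull(z;p′)` of B4 (2.46):
`u·R_l/E = \overline{… }`-free form `V_l R_l / E`. [folklore] -/
def coef {m : ℕ} (n : ℕ) [NeZero n] (a m2 : ℝ) (l : Fin m → Fin n) (P : Fin m → ℂ) : ℂ :=
  V n l P * R n m2 l P / E n a m2 P

/-- `Gfull(z;p′) = Σ_l PhZ_l(z;p′) · coef_l(p′)`. [folklore] -/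
theorem Gfull_eq_sum_coef {m : ℕ} (n : ℕ) [NeZero n] (a m2 : ℝ) (z : Fin m → ℤ) (P : Fin m → ℂ) :
    Gfull n a m2 z P = ∑ l : Fin m → Fin n, PhZ n l z P * coef n a m2 l P :=
  Finset.sum_congr rfl fun l _ => by unfold coef; ring

/-- on the real zone `|coef_l|² = U_l R_l² / E²` (`ū u = |u|²`, `R`, `E` real). [folklore] -/
theorem conj_coef_mul_coef {m : ℕ} (n : ℕ) [NeZero n] (hn : 1 ≤ n) (a m2 : ℝ) (l : Fin m → Fin n)
    (p : Fin m → ℝ) (hp : p ∈ BZ m) :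
    conj (coef n a m2 l (ofRealVec p)) * coef n a m2 l (ofRealVec p)
      = U n l (ofRealVec p) * R n m2 l (ofRealVec p) ^ 2 / E n a m2 (ofRealVec p) ^ 2 := by
  unfold coef
  rw [map_div₀, map_mul, conj_R_ofReal, conj_E_ofReal, ← conj_V_mul_V n hn l p hp]
  ring

/-- **PLANCHEREL ON THE FINE TORUS FOR TWO FIBRE SOLUTIONS**: for dual-grid momenta `p′_k, p′_{k′}`,
`Σ_{z ∈ Π_μ[0,nN_μ)} \overline{Gfull(z;p′_k)} Gfull(z;p′_{k′}) = [k = k′] · Π_μN_μ · n^{d+1} · qggqSymbol(p′_k)`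
(orthogonality of the modes `e^{i(p′_k+2πl)·z}`, `sum_box_conj_PhZ_mul_PhZ`, and `|coef_l|² = U_l R_l²/E²`). [folklore] -/
theorem sum_box_conj_Gfull_mul_Gfull (n : ℕ) [NeZero n] (hn1 : 1 ≤ n) (a m2 : ℝ) {N : Fin (d + 1) → ℕ}
    (hN : ∀ i, 1 ≤ N i) (k k' : (i : Fin (d + 1)) → Fin (N i)) :
    ∑ z ∈ box (fun i => n * N i), conj (Gfull n a m2 z (ofRealVec (dualMomentum N k)))
        * Gfull n a m2 z (ofRealVec (dualMomentum N k'))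
      = if k = k' then (∏ i, ((N i : ℕ) : ℂ)) * (n : ℂ) ^ (d + 1) * qggqSymbol n a m2 (ofRealVec (dualMomentum N k))
        else 0 := by
  classical
  have h1 : ∀ z : Fin (d + 1) → ℤ, conj (Gfull n a m2 z (ofRealVec (dualMomentum N k)))
        * Gfull n a m2 z (ofRealVec (dualMomentum N k'))
      = ∑ l : Fin (d + 1) → Fin n, ∑ l' : Fin (d + 1) → Fin n,
          conj (coef n a m2 l (ofRealVec (dualMomentum N k))) * coef n a m2 l' (ofRealVec (dualMomentum N k'))
            * (conj (PhZ n l z (ofRealVec (dualMomentum N k))) * PhZ n l' z (ofRealVec (dualMomentum N k'))) := by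
    intro z
    rw [Gfull_eq_sum_coef, Gfull_eq_sum_coef, map_sum, Finset.sum_mul_sum]
    refine Finset.sum_congr rfl fun l _ => Finset.sum_congr rfl fun l' _ => ?_
    rw [map_mul]
    ring
  calc ∑ z ∈ box (fun i => n * N i), conj (Gfull n a m2 z (ofRealVec (dualMomentum N k)))
          * Gfull n a m2 z (ofRealVec (dualMomentum N k'))
      = ∑ z ∈ box (fun i => n * N i), ∑ l : Fin (d + 1) → Fin n, ∑ l' : Fin (d + 1) → Fin n,
          conj (coef n a m2 l (ofRealVec (dualMomentum N k))) * coef n a m2 l' (ofRealVec (dualMomentum N k'))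
            * (conj (PhZ n l z (ofRealVec (dualMomentum N k))) * PhZ n l' z (ofRealVec (dualMomentum N k'))) :=
        Finset.sum_congr rfl fun z _ => h1 z
    _ = ∑ l : Fin (d + 1) → Fin n, ∑ l' : Fin (d + 1) → Fin n, ∑ z ∈ box (fun i => n * N i),
          conj (coef n a m2 l (ofRealVec (dualMomentum N k))) * coef n a m2 l' (ofRealVec (dualMomentum N k'))
            * (conj (PhZ n l z (ofRealVec (dualMomentum N k))) * PhZ n l' z (ofRealVec (dualMomentum N k'))) := by
        rw [Finset.sum_comm]
        exact Finset.sum_congr rfl fun l _ => Finset.sum_comm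
    _ = ∑ l : Fin (d + 1) → Fin n, ∑ l' : Fin (d + 1) → Fin n,
          conj (coef n a m2 l (ofRealVec (dualMomentum N k))) * coef n a m2 l' (ofRealVec (dualMomentum N k'))
            * (if k = k' ∧ l = l' then (∏ i, ((N i : ℕ) : ℂ)) * (n : ℂ) ^ (d + 1) else 0) := by
        refine Finset.sum_congr rfl fun l _ => Finset.sum_congr rfl fun l' _ => ?_
        rw [← Finset.mul_sum, sum_box_conj_PhZ_mul_PhZ n hN]
    _ = _ := by
        by_cases hk : k = k'
        · subst hk
          simp only [true_and, mul_ite, mul_zero, Finset.sum_ite_eq, Finset.mem_univ, if_true]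
          rw [qggqSymbol, Finset.mul_sum]
          refine Finset.sum_congr rfl fun l _ => ?_
          rw [← conj_coef_mul_coef n hn1 a m2 l _ (dualMomentum_mem_BZ N k)]
          ring
        · rw [if_neg hk]
          refine Finset.sum_eq_zero fun l _ => Finset.sum_eq_zero fun l' _ => ?_
          rw [if_neg (fun h => hk h.1), mul_zero]

/-! ### §4 The operator `Q′G′(m²)²Q′^*` on the unit torus and its Fourier representation ((1.45) as an operator identity) -/

/-- **THE MATRIX OF `Q′_kG′_k(m²)²Q′_k^*` ON THE UNIT TORUS `T₁ = Π_μ ℤ/N_μ`** (ξ-units; `G′(m²) = D⁻¹`,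
`D = −Δ^ξ + m² + aQ′^*Q′ = B4Green244.opD` on `(nN_μ)_μ`-periodic functions of the fine torus `T_ξ = Π_μ ℤ/(nN_μ)`;
`K_T(·,y) = G′Q′^*δ^T_y`, `B4TorusGreen244.KT` / `B4TorusPositivity.torusGreen244_unique`):
`(Q′G′²Q′^*)(y,y′) = ⟨G′Q′^*δ_y, G′Q′^*δ_{y′}⟩_ξ = ξ^{d+1} Σ_{z ∈ T_ξ} \overline{K_T(z,y)} K_T(z,y′)` (`G′` symmetric; the
meaning `= (Q′(G′(G′Q′^*δ_{y′})))(y)` is `qggq_eq_blockAvg`). [cite: Balaban1984PropagatorsI, p.25 (paragraph after (1.44): "⟨ω, Q′_kG′_k²Q′_k^*ω⟩ = ‖G′_kQ′_k^*ω‖²")] -/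
def qggq (n : ℕ) [NeZero n] (a m2 : ℝ) (N : Fin (d + 1) → ℕ) (y y' : Fin (d + 1) → ℤ) : ℂ :=
  ((n : ℂ) ^ (d + 1))⁻¹ * ∑ z ∈ box (fun i => n * N i), conj (KT n a m2 N z y) * KT n a m2 N z y'

/-- `K_T` with the grid character made explicit: `K_T(z,y) = Σ_k (Π N)⁻¹ · mFourier(−y)(k/N) · Gfull(z;p′_k)`. [folklore] -/
theorem KT_eq_sum_mFourier (n : ℕ) [NeZero n] (a m2 : ℝ) (N : Fin (d + 1) → ℕ) (z y : Fin (d + 1) → ℤ) :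
    KT n a m2 N z y = ∑ k : (i : Fin (d + 1)) → Fin (N i),
      (∏ i, ((N i : ℕ) : ℂ))⁻¹ * mFourier (-y) (MultiPeriod.gridPt N k) * Gfull n a m2 z (ofRealVec (dualMomentum N k)) := by
  rw [KT_eq_sum]
  refine Finset.sum_congr rfl fun k _ => ?_
  rw [cexp_neg_phase_eq_mFourier]

/-- **(1.45) AS AN OPERATOR IDENTITY ON THE FINITE TORUS (general `m² ≥ 0`).**  *"It is a translation invariant operator
on the unit lattice T₁^{(k)} and its Fourier transform can be written using formula (2.48) from [2]"* (B5 p.25, last two sentences):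
for `n ≥ 1`, `N_μ ≥ 1` and all `y, y′ ∈ ℤ^{d+1}`,
`(Q′G′(m²)²Q′^*)(y,y′) = (Π_μ N_μ)⁻¹ Σ_{k ∈ Π_μ ℤ/N_μ} qggqSymbol(p′_k) · e^{ip′_k·(y−y′)}`,  `p′_k = 2π k/N` —
a circulant on `T₁` whose eigenvalue at the dual momentum `p′_k` is the symbol of §3 (Plancherel on `T_ξ`,
`sum_box_conj_Gfull_mul_Gfull`, applied to the dual-grid expansion `B4TorusGreen244.KT_eq_sum` of both kernels).
[cite: Balaban1984PropagatorsI, p.25 (last two sentences) – p.26 (1.45)] -/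
theorem qggq_eq_circulant (n : ℕ) [NeZero n] (hn1 : 1 ≤ n) (a m2 : ℝ) {N : Fin (d + 1) → ℕ} (hN : ∀ i, 1 ≤ N i)
    (y y' : Fin (d + 1) → ℤ) :
    qggq n a m2 N y y' = (∏ i, ((N i : ℕ) : ℂ))⁻¹ * ∑ k : (i : Fin (d + 1)) → Fin (N i),
      qggqSymbol n a m2 (ofRealVec (dualMomentum N k)) * mFourier (y - y') (MultiPeriod.gridPt N k) := by
  classical
  have hNC : (∏ i, ((N i : ℕ) : ℂ)) ≠ 0 :=
    Finset.prod_ne_zero_iff.mpr fun i _ => Nat.cast_ne_zero.mpr (by have := hN i; omega)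
  have hnC : ((n : ℂ) ^ (d + 1)) ≠ 0 := pow_ne_zero _ (Nat.cast_ne_zero.mpr (NeZero.ne n))
  have h1 : ∀ z : Fin (d + 1) → ℤ, conj (KT n a m2 N z y) * KT n a m2 N z y'
      = ∑ k : (i : Fin (d + 1)) → Fin (N i), ∑ k' : (i : Fin (d + 1)) → Fin (N i),
          (∏ i, ((N i : ℕ) : ℂ))⁻¹ * (∏ i, ((N i : ℕ) : ℂ))⁻¹
            * (mFourier y (MultiPeriod.gridPt N k) * mFourier (-y') (MultiPeriod.gridPt N k'))
            * (conj (Gfull n a m2 z (ofRealVec (dualMomentum N k))) * Gfull n a m2 z (ofRealVec (dualMomentum N k'))) := by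
    intro z
    rw [KT_eq_sum_mFourier, KT_eq_sum_mFourier, map_sum, Finset.sum_mul_sum]
    refine Finset.sum_congr rfl fun k _ => Finset.sum_congr rfl fun k' _ => ?_
    rw [map_mul, map_mul, map_inv₀, map_prod, conj_mFourier_neg]
    simp only [map_natCast]
    ring
  unfold qggq
  calc ((n : ℂ) ^ (d + 1))⁻¹ * ∑ z ∈ box (fun i => n * N i), conj (KT n a m2 N z y) * KT n a m2 N z y'
      = ((n : ℂ) ^ (d + 1))⁻¹ * ∑ z ∈ box (fun i => n * N i),
          ∑ k : (i : Fin (d + 1)) → Fin (N i), ∑ k' : (i : Fin (d + 1)) → Fin (N i),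
          (∏ i, ((N i : ℕ) : ℂ))⁻¹ * (∏ i, ((N i : ℕ) : ℂ))⁻¹
            * (mFourier y (MultiPeriod.gridPt N k) * mFourier (-y') (MultiPeriod.gridPt N k'))
            * (conj (Gfull n a m2 z (ofRealVec (dualMomentum N k))) * Gfull n a m2 z (ofRealVec (dualMomentum N k'))) := by
        rw [Finset.sum_congr rfl fun z _ => h1 z]
    _ = ((n : ℂ) ^ (d + 1))⁻¹ * ∑ k : (i : Fin (d + 1)) → Fin (N i), ∑ k' : (i : Fin (d + 1)) → Fin (N i),
          ∑ z ∈ box (fun i => n * N i),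
          (∏ i, ((N i : ℕ) : ℂ))⁻¹ * (∏ i, ((N i : ℕ) : ℂ))⁻¹
            * (mFourier y (MultiPeriod.gridPt N k) * mFourier (-y') (MultiPeriod.gridPt N k'))
            * (conj (Gfull n a m2 z (ofRealVec (dualMomentum N k))) * Gfull n a m2 z (ofRealVec (dualMomentum N k'))) := by
        rw [Finset.sum_comm]
        congr 1
        exact Finset.sum_congr rfl fun k _ => Finset.sum_comm
    _ = ((n : ℂ) ^ (d + 1))⁻¹ * ∑ k : (i : Fin (d + 1)) → Fin (N i), ∑ k' : (i : Fin (d + 1)) → Fin (N i),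
          (∏ i, ((N i : ℕ) : ℂ))⁻¹ * (∏ i, ((N i : ℕ) : ℂ))⁻¹
            * (mFourier y (MultiPeriod.gridPt N k) * mFourier (-y') (MultiPeriod.gridPt N k'))
            * (if k = k' then (∏ i, ((N i : ℕ) : ℂ)) * (n : ℂ) ^ (d + 1) * qggqSymbol n a m2 (ofRealVec (dualMomentum N k))
               else 0) := by
        congr 1
        refine Finset.sum_congr rfl fun k _ => Finset.sum_congr rfl fun k' _ => ?_
        rw [← Finset.mul_sum, sum_box_conj_Gfull_mul_Gfull n hn1 a m2 hN]
    _ = _ := by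
        simp only [mul_ite, mul_zero, Finset.sum_ite_eq, Finset.mem_univ, if_true]
        rw [Finset.mul_sum, Finset.mul_sum]
        refine Finset.sum_congr rfl fun k _ => ?_
        rw [sub_eq_add_neg, mFourier_add]
        field_simp

/-- **(1.45), THE MASSLESS CASE OF THE PAPER: `(Q′_kG′_k²Q′_k^*)~(p′) = 𝒩(p′)/E(p′)² = mReg(p′)`** — the matrix of
`Q′G′²Q′^*` (`m² = 0`) on the unit torus is the circulant with eigenvalues `B5Strip145.mReg(p′_k)` at the dual momenta
(`= m145(p′_k)`, the display (1.45) transcribed literally, for `p′_k ≠ 0`: `B5Strip145.m145_eq_mReg_real`).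
[cite: Balaban1984PropagatorsI, (1.45) p.26] -/
theorem qggq_zero_eq_circulant_mReg (n : ℕ) [NeZero n] (hn1 : 1 ≤ n) (a : ℝ) {N : Fin (d + 1) → ℕ}
    (hN : ∀ i, 1 ≤ N i) (y y' : Fin (d + 1) → ℤ) :
    qggq n a 0 N y y' = (∏ i, ((N i : ℕ) : ℂ))⁻¹ * ∑ k : (i : Fin (d + 1)) → Fin (N i),
      mReg n a (ofRealVec (dualMomentum N k)) * mFourier (y - y') (MultiPeriod.gridPt N k) := by
  rw [qggq_eq_circulant n hn1 a 0 hN]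
  simp_rw [qggqSymbol_zero_eq_mReg]

/-! ### §5 What the definition means: `qggq(y,y′) = (Q′ G′ G′ Q′^* δ_{y′})(y)` (Hermitian symmetry of `D` on the torus) -/

/-- two integers of `[0,N)` (resp. one of `(−N,N)`) congruent mod `N` are equal (resp. zero). [folklore] -/
theorem int_eq_zero_of_dvd_of_lt {N : ℕ} {t : ℤ} (h : (N : ℤ) ∣ t) (h1 : -(N : ℤ) < t) (h2 : t < N) : t = 0 := by
  obtain ⟨c, hc⟩ := h
  rcases lt_trichotomy c 0 with hc0 | hc0 | hc0
  · have : (N : ℤ) * c ≤ -(N : ℤ) := by nlinarith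
    omega
  · subst hc0; omega
  · have : (N : ℤ) ≤ (N : ℤ) * c := by nlinarith
    omega

/-- on the unit torus the indicator `1[x ≡ y mod N]` of `torusGreen244` is `1[x = y]` for representatives in the box. [folklore] -/
theorem dvd_sub_iff_eq_of_mem_box {N : Fin (d + 1) → ℕ} {x y : Fin (d + 1) → ℤ} (hx : x ∈ box N) (hy : y ∈ box N) :
    (∀ i, (N i : ℤ) ∣ x i - y i) ↔ x = y := by
  rw [mem_box] at hx hy
  refine ⟨fun h => funext fun i => ?_, fun h i => by rw [h, sub_self]; exact dvd_zero _⟩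
  have h1 := hx i
  have h2 := hy i
  have := int_eq_zero_of_dvd_of_lt (h i) (by omega) (by omega)
  omega

/-- **`−Δ^ξ` IS HERMITIAN ON THE TORUS**: `Σ_{z∈T} conj φ(z)·(−Δ^ξψ)(z) = Σ_{z∈T} conj((−Δ^ξφ)(z))·ψ(z)` for periodic `φ, ψ`
(periodic summation by parts, both shifts). [folklore] -/
theorem sum_box_conj_mul_negLap (n : ℕ) {P : Fin (d + 1) → ℕ} (hP : ∀ i, 1 ≤ P i) {φ ψ : (Fin (d + 1) → ℤ) → ℂ}
    (hφ : IsPeriodic P φ) (hψ : IsPeriodic P ψ) :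
    ∑ z ∈ box P, conj (φ z) * negLap n ψ z = ∑ z ∈ box P, conj (negLap n φ z) * ψ z := by
  have hdir : ∀ μ : Fin (d + 1), ∑ z ∈ box P, conj (φ z) * (2 * ψ z - ψ (z + e μ) - ψ (z - e μ))
      = ∑ z ∈ box P, conj (2 * φ z - φ (z + e μ) - φ (z - e μ)) * ψ z := by
    intro μ
    have h1 : ∑ z ∈ box P, conj (φ z) * ψ (z + e μ) = ∑ z ∈ box P, conj (φ (z - e μ)) * ψ z := by
      have hper : IsPeriodic P (fun w => conj (φ (w - e μ)) * ψ w) := fun z m => by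
        show conj (φ (MultiPeriod.translate P z m - e μ)) * ψ (MultiPeriod.translate P z m) = conj (φ (z - e μ)) * ψ z
        rw [translate_sub_right, hφ, hψ]
      have := IsPeriodic.sum_box_add hP hper (e μ)
      simpa only [add_sub_cancel_right] using this
    have h2 : ∑ z ∈ box P, conj (φ z) * ψ (z - e μ) = ∑ z ∈ box P, conj (φ (z + e μ)) * ψ z := by
      have hper : IsPeriodic P (fun w => conj (φ (w + e μ)) * ψ w) := fun z m => by
        show conj (φ (MultiPeriod.translate P z m + e μ)) * ψ (MultiPeriod.translate P z m) = conj (φ (z + e μ)) * ψ z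
        rw [translate_add_right, hφ, hψ]
      have := IsPeriodic.sum_box_add hP hper (-e μ)
      simpa only [neg_add_cancel_right, ← sub_eq_add_neg, sub_add_cancel] using this
    have eL : ∑ z ∈ box P, conj (φ z) * (2 * ψ z - ψ (z + e μ) - ψ (z - e μ))
        = 2 * ∑ z ∈ box P, conj (φ z) * ψ z - ∑ z ∈ box P, conj (φ z) * ψ (z + e μ)
          - ∑ z ∈ box P, conj (φ z) * ψ (z - e μ) := by
      rw [Finset.mul_sum, ← Finset.sum_sub_distrib, ← Finset.sum_sub_distrib]
      exact Finset.sum_congr rfl fun z _ => by ring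
    have eR : ∑ z ∈ box P, conj (2 * φ z - φ (z + e μ) - φ (z - e μ)) * ψ z
        = 2 * ∑ z ∈ box P, conj (φ z) * ψ z - ∑ z ∈ box P, conj (φ (z + e μ)) * ψ z
          - ∑ z ∈ box P, conj (φ (z - e μ)) * ψ z := by
      rw [Finset.mul_sum, ← Finset.sum_sub_distrib, ← Finset.sum_sub_distrib]
      exact Finset.sum_congr rfl fun z _ => by simp only [map_sub, map_mul, map_ofNat]; ring
    rw [eL, eR, h1, h2]
    ring
  have eL : ∑ z ∈ box P, conj (φ z) * negLap n ψ z
      = (n : ℂ) ^ 2 * ∑ μ : Fin (d + 1), ∑ z ∈ box P, conj (φ z) * (2 * ψ z - ψ (z + e μ) - ψ (z - e μ)) := by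
    unfold negLap
    rw [Finset.sum_comm, Finset.mul_sum]
    refine Finset.sum_congr rfl fun z _ => ?_
    rw [Finset.mul_sum, Finset.mul_sum, Finset.mul_sum]
    exact Finset.sum_congr rfl fun μ _ => by ring
  have eR : ∑ z ∈ box P, conj (negLap n φ z) * ψ z
      = (n : ℂ) ^ 2 * ∑ μ : Fin (d + 1), ∑ z ∈ box P, conj (2 * φ z - φ (z + e μ) - φ (z - e μ)) * ψ z := by
    unfold negLap
    rw [Finset.sum_comm, Finset.mul_sum]
    refine Finset.sum_congr rfl fun z _ => ?_
    rw [map_mul, map_sum, Finset.mul_sum, Finset.sum_mul, Finset.mul_sum]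
    refine Finset.sum_congr rfl fun μ _ => ?_
    rw [map_pow, map_natCast]
    ring
  rw [eL, eR]
  congr 1
  exact Finset.sum_congr rfl fun μ _ => hdir μ

/-- **`Q′^*Q′` IS HERMITIAN ON THE TORUS**: `Σ_{z∈T} conj φ(z)·(Q^*Qψ)(z) = Σ_{z∈T} conj((Q^*Qφ)(z))·ψ(z)`
(`= n^{−(d+1)} Σ_x \overline{Σ_{z∈B(x)}φ} Σ_{z∈B(x)}ψ`, block by block). [folklore] -/
theorem sum_box_conj_mul_blockAvg (n : ℕ) [NeZero n] (N : Fin (d + 1) → ℕ) (φ ψ : (Fin (d + 1) → ℤ) → ℂ) :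
    ∑ z ∈ box (fun i => n * N i), conj (φ z) * blockAvg n ψ z
      = ∑ z ∈ box (fun i => n * N i), conj (blockAvg n φ z) * ψ z := by
  rw [sum_box_fine, sum_box_fine]
  refine Finset.sum_congr rfl fun x _ => ?_
  unfold blockAvg
  simp_rw [coarse_finePt]
  trans ((n : ℂ) ^ (d + 1))⁻¹ * ((∑ t : Fin (d + 1) → Fin n, conj (φ (finePt n x t)))
    * ∑ j : Fin (d + 1) → Fin n, ψ (finePt n x j))
  · rw [← Finset.sum_mul]
    ring
  · rw [← Finset.mul_sum, map_mul, map_inv₀, map_pow, map_natCast, map_sum]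
    ring

/-- **`D = −Δ^ξ + m² + aQ′^*Q′` IS HERMITIAN ON THE TORUS** (`G′ = D⁻¹` symmetric, used silently on B5 p.25:
`Q′G′²Q′^* = (G′Q′^*)^*(G′Q′^*)`). [folklore] -/
theorem sum_box_conj_mul_opD (n : ℕ) [NeZero n] (a m2 : ℝ) {N : Fin (d + 1) → ℕ} (hN : ∀ i, 1 ≤ N i)
    {φ ψ : (Fin (d + 1) → ℤ) → ℂ} (hφ : IsPeriodic (fun i => n * N i) φ) (hψ : IsPeriodic (fun i => n * N i) ψ) :
    ∑ z ∈ box (fun i => n * N i), conj (φ z) * opD n a m2 ψ z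
      = ∑ z ∈ box (fun i => n * N i), conj (opD n a m2 φ z) * ψ z := by
  have hP := period_pos n hN
  have e1 : ∀ z, conj (φ z) * opD n a m2 ψ z
      = conj (φ z) * negLap n ψ z + m2 * (conj (φ z) * ψ z) + a * (conj (φ z) * blockAvg n ψ z) := by
    intro z; unfold opD; ring
  have e2 : ∀ z, conj (opD n a m2 φ z) * ψ z
      = conj (negLap n φ z) * ψ z + m2 * (conj (φ z) * ψ z) + a * (conj (blockAvg n φ z) * ψ z) := by
    intro z
    unfold opD
    simp only [map_add, map_mul, Complex.conj_ofReal]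
    ring
  simp_rw [e1, e2, Finset.sum_add_distrib, ← Finset.mul_sum]
  rw [sum_box_conj_mul_negLap n hP hφ hψ, sum_box_conj_mul_blockAvg]

/-- `K_T(·,y) = G′Q′^*δ^T_y` is a periodic function on the fine torus. [folklore] -/
theorem KT_isPeriodic (n : ℕ) [NeZero n] (a m2 : ℝ) {N : Fin (d + 1) → ℕ} (hN : ∀ i, 1 ≤ N i) (y : Fin (d + 1) → ℤ) :
    IsPeriodic (fun i => n * N i) (fun z => KT n a m2 N z y) :=
  fun z m => KT_translate_left n a m2 hN z y m

/-- **`G′²Q′^*δ_{y′}` EXISTS AND IS UNIQUE ON THE TORUS**: there is exactly one periodic `ψ` with `Dψ = K_T(·,y′)`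
(`B4TorusPositivity.torusGreen_existsUnique`; `a > 0`, `m² ≥ 0`). [folklore] -/
theorem existsUnique_GGQ (n : ℕ) [NeZero n] (a m2 : ℝ) (ha : 0 < a) (hm : 0 ≤ m2) {N : Fin (d + 1) → ℕ}
    (hN : ∀ i, 1 ≤ N i) (y' : Fin (d + 1) → ℤ) :
    ∃! ψ : (Fin (d + 1) → ℤ) → ℂ, IsPeriodic (fun i => n * N i) ψ ∧ ∀ z, opD n a m2 ψ z = KT n a m2 N z y' :=
  torusGreen_existsUnique n a m2 ha hm hN _ (KT_isPeriodic n a m2 hN y')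

/-- **THE DEFINITION MEANS `Q′G′²Q′^*`**: for `y ∈ Π_μ[0,N_μ)` (a representative of the unit torus) and THE periodic
solution `ψ = G′(G′Q′^*δ_{y′}) = G′²Q′^*δ_{y′}` of `Dψ = K_T(·,y′)` (`existsUnique_GGQ`),
`qggq(y,y′) = ξ^{d+1} Σ_{z ∈ B(y)} ψ(z) = (Q′ψ)(y) = (Q′G′²Q′^*δ_{y′})(y)`
(`Σ_z \overline{K_T(z,y)}(Dψ)(z) = Σ_z \overline{(DK_T(·,y))(z)} ψ(z) = Σ_{z∈B(y)} ψ(z)` by `sum_box_conj_mul_opD` and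
`torusGreen244`). [cite: Balaban1984PropagatorsI, p.25 (paragraph after (1.44)); dictionary (Q′ = block average, G′ = D⁻¹ on the torus)] -/
theorem qggq_eq_blockAvg (n : ℕ) [NeZero n] (hn1 : 1 ≤ n) (a m2 : ℝ) (ha : 0 < a) (hm : 0 ≤ m2)
    {N : Fin (d + 1) → ℕ} (hN : ∀ i, 1 ≤ N i) {y : Fin (d + 1) → ℤ} (hy : y ∈ box N) (y' : Fin (d + 1) → ℤ)
    (ψ : (Fin (d + 1) → ℤ) → ℂ) (hψ : IsPeriodic (fun i => n * N i) ψ) (hDψ : ∀ z, opD n a m2 ψ z = KT n a m2 N z y') :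
    qggq n a m2 N y y' = ((n : ℂ) ^ (d + 1))⁻¹ * ∑ j : Fin (d + 1) → Fin n, ψ (finePt n y j) := by
  classical
  unfold qggq
  congr 1
  calc ∑ z ∈ box (fun i => n * N i), conj (KT n a m2 N z y) * KT n a m2 N z y'
      = ∑ z ∈ box (fun i => n * N i), conj (KT n a m2 N z y) * opD n a m2 ψ z :=
        Finset.sum_congr rfl fun z _ => by rw [hDψ]
    _ = ∑ z ∈ box (fun i => n * N i), conj (opD n a m2 (fun z' => KT n a m2 N z' y) z) * ψ z :=
        sum_box_conj_mul_opD n a m2 hN (KT_isPeriodic n a m2 hN y) hψ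
    _ = ∑ z ∈ box (fun i => n * N i), if (∀ i, (N i : ℤ) ∣ coarse n z i - y i) then ψ z else 0 := by
        refine Finset.sum_congr rfl fun z _ => ?_
        rw [torusGreen244 n hn1 a m2 ha hm hN]
        split_ifs <;> simp
    _ = ∑ x ∈ box N, ∑ j : Fin (d + 1) → Fin n, if x = y then ψ (finePt n x j) else 0 := by
        rw [sum_box_fine]
        refine Finset.sum_congr rfl fun x hx => Finset.sum_congr rfl fun j _ => ?_
        rw [coarse_finePt]
        exact if_congr (dvd_sub_iff_eq_of_mem_box hx hy) rfl rfl
    _ = ∑ j : Fin (d + 1) → Fin n, ψ (finePt n y j) := by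
        rw [Finset.sum_comm]
        refine Finset.sum_congr rfl fun j _ => ?_
        rw [Finset.sum_ite_eq' (box N) y (fun x => ψ (finePt n x j)), if_pos hy]

/-- `qggq` is `N`-periodic in each slot (a kernel on the unit torus `T₁`). [folklore] -/
theorem qggq_translate (n : ℕ) [NeZero n] (a m2 : ℝ) {N : Fin (d + 1) → ℕ} (hN : ∀ i, 1 ≤ N i)
    (y y' m m' : Fin (d + 1) → ℤ) :
    qggq n a m2 N (MultiPeriod.translate N y m) (MultiPeriod.translate N y' m') = qggq n a m2 N y y' := by
  unfold qggq
  simp_rw [KT_translate_right n a m2 hN]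

/-! ### §6 `mReg > 0` on the real zone; the pv17 kernel `torusKernel145M` is the inverse of `Q′G′²Q′^*` on the torus -/

/-- the regrouped multiplier on the real zone is the real number `𝒩_r(p′)/E_r(p′)²`. [folklore] -/
theorem mReg_ofReal {m : ℕ} (n : ℕ) [NeZero n] (a : ℝ) (s : Fin m → ℝ) :
    mReg n a (ofRealVec s) = ((Ncalr n s / Er n a 0 s ^ 2 : ℝ) : ℂ) := by
  unfold mReg
  rw [Ncal_ofReal, E_ofReal]
  push_cast
  ring

/-- **`Q′G′²Q′^*` IS POSITIVE DEFINITE, spectrally**: `𝒩_r(p′)/E_r(p′)² > 0` on `[−π,π]^m` (`a > 0`, `n ≥ 1`;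
`𝒩_r ≥ (4/π²)^m`, `E_r ≥ a(4/π²)^m`).  *"It is enough to prove that Q′_kG′_k²Q′_k^* is positive definite"* (B5 p.25, after (1.44)). [cite: Balaban1984PropagatorsI, p.25 (paragraph after (1.44): "positive definite", "0 < Q′_kG′_k²Q′_k^*")] -/
theorem mRegr_pos {m : ℕ} (n : ℕ) [NeZero n] (hn : 1 ≤ n) (a : ℝ) (ha : 0 < a) (s : Fin m → ℝ)
    (hs : ∀ μ, |s μ| ≤ Real.pi) : 0 < Ncalr n s / Er n a 0 s ^ 2 := by
  have h1 : (0 : ℝ) < (4 / Real.pi ^ 2) ^ m := by positivity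
  exact div_pos (h1.trans_le (Ncalr_ge n hn s hs))
    (pow_pos ((mul_pos ha h1).trans_le (Er_ge n hn a 0 ha.le le_rfl s hs)) 2)

/-- hence `mReg(p′_k) ≠ 0` at every dual-grid momentum. [folklore] -/
theorem mReg_dual_ne_zero (n : ℕ) [NeZero n] (hn : 1 ≤ n) (a : ℝ) (ha : 0 < a) (N : Fin (d + 1) → ℕ)
    (k : (i : Fin (d + 1)) → Fin (N i)) : mReg n a (ofRealVec (dualMomentum N k)) ≠ 0 := by
  have hp := dualMomentum_mem_BZ N k
  rw [mReg_ofReal, Complex.ofReal_ne_zero]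
  exact (mRegr_pos n hn a ha _ fun μ => abs_le.mpr ⟨hp.1 μ, hp.2 μ⟩).ne'

/-- a circulant on the unit torus with eigenvalue list `f`: `(Π N)⁻¹ Σ_k f(k) e^{ip′_k·x}`. [folklore] -/
def circ (N : Fin (d + 1) → ℕ) (f : ((i : Fin (d + 1)) → Fin (N i)) → ℂ) (x : Fin (d + 1) → ℤ) : ℂ :=
  (∏ i, ((N i : ℕ) : ℂ))⁻¹ * ∑ k : (i : Fin (d + 1)) → Fin (N i), f k * mFourier x (MultiPeriod.gridPt N k)

/-- **CIRCULANTS COMPOSE BY MULTIPLYING EIGENVALUES**: `Σ_{y′∈T₁} circ_f(y−y′) circ_g(y′−y″) = circ_{fg}(y−y″)`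
(character orthogonality `sum_box_mFourier_mul_conj`). [folklore] -/
theorem circ_conv {N : Fin (d + 1) → ℕ} (hN : ∀ i, 1 ≤ N i) (f g : ((i : Fin (d + 1)) → Fin (N i)) → ℂ)
    (y y'' : Fin (d + 1) → ℤ) :
    ∑ y' ∈ box N, circ N f (y - y') * circ N g (y' - y'') = circ N (fun k => f k * g k) (y - y'') := by
  classical
  have hNC : (∏ i, ((N i : ℕ) : ℂ)) ≠ 0 :=
    Finset.prod_ne_zero_iff.mpr fun i _ => Nat.cast_ne_zero.mpr (by have := hN i; omega)
  have h1 : ∀ y' : Fin (d + 1) → ℤ, circ N f (y - y') * circ N g (y' - y'')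
      = ∑ k : (i : Fin (d + 1)) → Fin (N i), ∑ k' : (i : Fin (d + 1)) → Fin (N i),
          (∏ i, ((N i : ℕ) : ℂ))⁻¹ * (∏ i, ((N i : ℕ) : ℂ))⁻¹ * (f k * g k')
            * (mFourier y (MultiPeriod.gridPt N k) * mFourier (-y'') (MultiPeriod.gridPt N k'))
            * (mFourier y' (MultiPeriod.gridPt N k') * conj (mFourier y' (MultiPeriod.gridPt N k))) := by
    intro y'
    unfold circ
    rw [Finset.mul_sum, Finset.mul_sum, Finset.sum_mul_sum]
    refine Finset.sum_congr rfl fun k _ => Finset.sum_congr rfl fun k' _ => ?_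
    rw [sub_eq_add_neg, mFourier_add, mFourier_neg, sub_eq_add_neg, mFourier_add]
    ring
  calc ∑ y' ∈ box N, circ N f (y - y') * circ N g (y' - y'')
      = ∑ y' ∈ box N, ∑ k : (i : Fin (d + 1)) → Fin (N i), ∑ k' : (i : Fin (d + 1)) → Fin (N i),
          (∏ i, ((N i : ℕ) : ℂ))⁻¹ * (∏ i, ((N i : ℕ) : ℂ))⁻¹ * (f k * g k')
            * (mFourier y (MultiPeriod.gridPt N k) * mFourier (-y'') (MultiPeriod.gridPt N k'))
            * (mFourier y' (MultiPeriod.gridPt N k') * conj (mFourier y' (MultiPeriod.gridPt N k))) :=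
        Finset.sum_congr rfl fun y' _ => h1 y'
    _ = ∑ k : (i : Fin (d + 1)) → Fin (N i), ∑ k' : (i : Fin (d + 1)) → Fin (N i), ∑ y' ∈ box N,
          (∏ i, ((N i : ℕ) : ℂ))⁻¹ * (∏ i, ((N i : ℕ) : ℂ))⁻¹ * (f k * g k')
            * (mFourier y (MultiPeriod.gridPt N k) * mFourier (-y'') (MultiPeriod.gridPt N k'))
            * (mFourier y' (MultiPeriod.gridPt N k') * conj (mFourier y' (MultiPeriod.gridPt N k))) := by
        rw [Finset.sum_comm]
        exact Finset.sum_congr rfl fun k _ => Finset.sum_comm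
    _ = ∑ k : (i : Fin (d + 1)) → Fin (N i), ∑ k' : (i : Fin (d + 1)) → Fin (N i),
          (∏ i, ((N i : ℕ) : ℂ))⁻¹ * (∏ i, ((N i : ℕ) : ℂ))⁻¹ * (f k * g k')
            * (mFourier y (MultiPeriod.gridPt N k) * mFourier (-y'') (MultiPeriod.gridPt N k'))
            * (if k = k' then ∏ i, ((N i : ℕ) : ℂ) else 0) := by
        refine Finset.sum_congr rfl fun k _ => Finset.sum_congr rfl fun k' _ => ?_
        rw [← Finset.mul_sum, sum_box_mFourier_mul_conj hN]
    _ = _ := by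
        simp only [mul_ite, mul_zero, Finset.sum_ite_eq, Finset.mem_univ, if_true]
        unfold circ
        rw [Finset.mul_sum]
        refine Finset.sum_congr rfl fun k _ => ?_
        rw [sub_eq_add_neg, mFourier_add]
        field_simp

/-- the pv17 kernel is the circulant of `mReg(p′_k)⁻¹`. [folklore] -/
theorem torusKernel145M_eq_circ (n : ℕ) [NeZero n] (a : ℝ) (N : Fin (d + 1) → ℕ) (x : Fin (d + 1) → ℤ) :
    torusKernel145M n a N x = circ N (fun k => (mReg n a (ofRealVec (dualMomentum N k)))⁻¹) x := rfl

/-- `Q′G′²Q′^*` (`m² = 0`) is the circulant of `mReg(p′_k)` (`qggq_zero_eq_circulant_mReg`). [folklore] -/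
theorem qggq_zero_eq_circ (n : ℕ) [NeZero n] (hn1 : 1 ≤ n) (a : ℝ) {N : Fin (d + 1) → ℕ} (hN : ∀ i, 1 ≤ N i)
    (y y' : Fin (d + 1) → ℤ) :
    qggq n a 0 N y y' = circ N (fun k => mReg n a (ofRealVec (dualMomentum N k))) (y - y') :=
  qggq_zero_eq_circulant_mReg n hn1 a hN y y'

/-- the identity circulant is `δ^{T₁}`: `(ΠN)⁻¹ Σ_k e^{ip′_k·x} = 1[x ≡ 0 mod N]`. [folklore] -/
theorem circ_one {N : Fin (d + 1) → ℕ} (hN : ∀ i, 1 ≤ N i) (x : Fin (d + 1) → ℤ) :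
    circ N (fun _ => 1) x = if ∀ i, (N i : ℤ) ∣ x i then 1 else 0 := by
  have hNC : (∏ i, ((N i : ℕ) : ℂ)) ≠ 0 :=
    Finset.prod_ne_zero_iff.mpr fun i _ => Nat.cast_ne_zero.mpr (by have := hN i; omega)
  unfold circ
  simp_rw [one_mul]
  rw [MultiPeriod.sum_mFourier_grid hN]
  split_ifs
  · exact inv_mul_cancel₀ hNC
  · exact mul_zero _

/-- **THE pv17 KERNEL INVERTS `Q′G′²Q′^*` ON THE TORUS (left)**: for `n ≥ 1`, `a > 0`, `N_μ ≥ 1`,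
`Σ_{y′ ∈ T₁} torusKernel145M(y − y′) · (Q′G′²Q′^*)(y′,y″) = δ^{T₁}(y − y″)` — the finite-torus kernel whose exponential
decay `B5Torus145Decay.inverse145_torusKernelM_decay_torusMetric` certifies IS the kernel of the operator
`(Q′_kG′_k²Q′_k^*)^{−1}` entering (1.44)/(1.46) (`m² = 0`, ξ-units, `U = 1`).
[cite: Balaban1984PropagatorsI, p.25 ((1.43)–(1.44), "the existence of the inverse operator"), p.26 (1.45)] -/
theorem torusKernel145M_conv_qggq (n : ℕ) [NeZero n] (hn1 : 1 ≤ n) (a : ℝ) (ha : 0 < a) {N : Fin (d + 1) → ℕ}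
    (hN : ∀ i, 1 ≤ N i) (y y'' : Fin (d + 1) → ℤ) :
    ∑ y' ∈ box N, torusKernel145M n a N (y - y') * qggq n a 0 N y' y''
      = if ∀ i, (N i : ℤ) ∣ y i - y'' i then 1 else 0 := by
  simp_rw [torusKernel145M_eq_circ, qggq_zero_eq_circ n hn1 a hN]
  rw [circ_conv hN, ← circ_one hN]
  congr 1
  funext k
  exact inv_mul_cancel₀ (mReg_dual_ne_zero n hn1 a ha N k)

/-- **… and (right)**: `Σ_{y′ ∈ T₁} (Q′G′²Q′^*)(y,y′) · torusKernel145M(y′ − y″) = δ^{T₁}(y − y″)`.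
[cite: Balaban1984PropagatorsI, p.25 ((1.43)–(1.44), "the existence of the inverse operator"), p.26 (1.45)] -/
theorem qggq_conv_torusKernel145M (n : ℕ) [NeZero n] (hn1 : 1 ≤ n) (a : ℝ) (ha : 0 < a) {N : Fin (d + 1) → ℕ}
    (hN : ∀ i, 1 ≤ N i) (y y'' : Fin (d + 1) → ℤ) :
    ∑ y' ∈ box N, qggq n a 0 N y y' * torusKernel145M n a N (y' - y'')
      = if ∀ i, (N i : ℤ) ∣ y i - y'' i then 1 else 0 := by
  simp_rw [torusKernel145M_eq_circ, qggq_zero_eq_circ n hn1 a hN]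
  rw [circ_conv hN, ← circ_one hN]
  congr 1
  funext k
  exact mul_inv_cancel₀ (mReg_dual_ne_zero n hn1 a ha N k)

/-! ### §7 The printed positivity argument: `⟨ω, Q′G′²Q′^*ω⟩ = ‖G′Q′^*ω‖²`, `= 0 ⇒ ω = 0`; the value `a⁻²` at `p′ = 0` -/

/-- `(G′Q′^*ω)(z) = Σ_{y∈T₁} ω(y) K_T(z,y)` for a function `ω` on the unit torus (read on the box `Π_μ[0,N_μ)`).
[cite: Balaban1984PropagatorsI, p.25 (paragraph after (1.44))] -/
def GQ (n : ℕ) [NeZero n] (a m2 : ℝ) (N : Fin (d + 1) → ℕ) (ω : (Fin (d + 1) → ℤ) → ℂ) (z : Fin (d + 1) → ℤ) : ℂ :=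
  ∑ y ∈ box N, ω y * KT n a m2 N z y

/-- `G′Q′^*ω` is periodic on the fine torus. [folklore] -/
theorem GQ_isPeriodic (n : ℕ) [NeZero n] (a m2 : ℝ) {N : Fin (d + 1) → ℕ} (hN : ∀ i, 1 ≤ N i)
    (ω : (Fin (d + 1) → ℤ) → ℂ) : IsPeriodic (fun i => n * N i) (GQ n a m2 N ω) := fun z m => by
  unfold GQ
  simp_rw [KT_translate_left n a m2 hN]

/-- `D(G′Q′^*ω) = Q′^*ω`: at a fine point over the unit-torus site `x ∈ Π_μ[0,N_μ)` the value is `ω(x)`. [folklore] -/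
theorem opD_GQ (n : ℕ) [NeZero n] (hn1 : 1 ≤ n) (a m2 : ℝ) (ha : 0 < a) (hm : 0 ≤ m2) {N : Fin (d + 1) → ℕ}
    (hN : ∀ i, 1 ≤ N i) (ω : (Fin (d + 1) → ℤ) → ℂ) {x : Fin (d + 1) → ℤ} (hx : x ∈ box N) (j : Fin (d + 1) → Fin n) :
    opD n a m2 (GQ n a m2 N ω) (finePt n x j) = ω x := by
  classical
  show opD n a m2 (fun z' => ∑ y ∈ box N, ω y * KT n a m2 N z' y) (finePt n x j) = ω x
  rw [opD_sum_mul]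
  simp_rw [torusGreen244 n hn1 a m2 ha hm hN, coarse_finePt]
  calc ∑ y ∈ box N, ω y * (if ∀ i, (N i : ℤ) ∣ x i - y i then 1 else 0)
      = ∑ y ∈ box N, ω y * (if x = y then 1 else 0) :=
        Finset.sum_congr rfl fun y hy => by rw [if_congr (dvd_sub_iff_eq_of_mem_box hx hy) rfl rfl]
    _ = ω x := by rw [Finset.sum_mul_boole, if_pos hx]

/-- **"THIS OPERATOR IS OF COURSE NONNEGATIVE": `⟨ω, Q′G′²Q′^*ω⟩ = ‖G′Q′^*ω‖²`** (B5 p.25, the paragraph after (1.44), verbatim: *"if for some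
ω defined on T₁^{(k)} we have ⟨ω, Q′_kG′_k²Q′_k^*ω⟩ = ‖G′_kQ′_k^*ω‖² = 0, then Q′_k^*ω = 0, hence ω = 0"*): for every `ω`
on the unit torus, `Σ_{y,y′∈T₁} conj ω(y) (Q′G′²Q′^*)(y,y′) ω(y′) = ξ^{d+1} Σ_{z∈T_ξ} |(G′Q′^*ω)(z)|²`.
[cite: Balaban1984PropagatorsI, p.25 (paragraph after (1.44))] -/
theorem gram_qggq (n : ℕ) [NeZero n] (a m2 : ℝ) (N : Fin (d + 1) → ℕ) (ω : (Fin (d + 1) → ℤ) → ℂ) :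
    ∑ y ∈ box N, ∑ y' ∈ box N, conj (ω y) * qggq n a m2 N y y' * ω y'
      = ((n : ℂ) ^ (d + 1))⁻¹ * ∑ z ∈ box (fun i => n * N i), ((‖GQ n a m2 N ω z‖ : ℝ) : ℂ) ^ 2 := by
  have h1 : ∀ z, ((‖GQ n a m2 N ω z‖ : ℝ) : ℂ) ^ 2
      = ∑ y ∈ box N, ∑ y' ∈ box N, conj (ω y) * conj (KT n a m2 N z y) * (ω y' * KT n a m2 N z y') := by
    intro z
    rw [← Complex.conj_mul', GQ, map_sum, Finset.sum_mul_sum]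
    exact Finset.sum_congr rfl fun y _ => Finset.sum_congr rfl fun y' _ => by rw [map_mul]
  have h2 : ∀ y y', conj (ω y) * qggq n a m2 N y y' * ω y'
      = ∑ z ∈ box (fun i => n * N i),
          ((n : ℂ) ^ (d + 1))⁻¹ * (conj (ω y) * conj (KT n a m2 N z y) * (ω y' * KT n a m2 N z y')) := by
    intro y y'
    rw [qggq, Finset.mul_sum, Finset.mul_sum, Finset.sum_mul]
    exact Finset.sum_congr rfl fun z _ => by ring
  calc ∑ y ∈ box N, ∑ y' ∈ box N, conj (ω y) * qggq n a m2 N y y' * ω y'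
      = ∑ y ∈ box N, ∑ y' ∈ box N, ∑ z ∈ box (fun i => n * N i),
          ((n : ℂ) ^ (d + 1))⁻¹ * (conj (ω y) * conj (KT n a m2 N z y) * (ω y' * KT n a m2 N z y')) :=
        Finset.sum_congr rfl fun y _ => Finset.sum_congr rfl fun y' _ => h2 y y'
    _ = ∑ y ∈ box N, ∑ z ∈ box (fun i => n * N i), ∑ y' ∈ box N,
          ((n : ℂ) ^ (d + 1))⁻¹ * (conj (ω y) * conj (KT n a m2 N z y) * (ω y' * KT n a m2 N z y')) :=
        Finset.sum_congr rfl fun y _ => Finset.sum_comm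
    _ = ∑ z ∈ box (fun i => n * N i), ∑ y ∈ box N, ∑ y' ∈ box N,
          ((n : ℂ) ^ (d + 1))⁻¹ * (conj (ω y) * conj (KT n a m2 N z y) * (ω y' * KT n a m2 N z y')) :=
        Finset.sum_comm
    _ = _ := by
        rw [Finset.mul_sum]
        refine Finset.sum_congr rfl fun z _ => ?_
        rw [h1, Finset.mul_sum]
        refine Finset.sum_congr rfl fun y _ => ?_
        rw [Finset.mul_sum]

/-- **"… THEN `Q′^*ω = 0`, HENCE `ω = 0`": `Q′G′²Q′^*` IS POSITIVE DEFINITE ON THE TORUS** — if the quadratic form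
vanishes then `ω = 0` on `T₁` (`‖G′Q′^*ω‖ = 0` ⇒ `G′Q′^*ω = 0` ⇒ apply `D`: `Q′^*ω = 0` ⇒ `ω = 0`; `a > 0`, `m² ≥ 0`,
`n ≥ 1`).  With `gram_qggq` this is the printed sentence *"We have bounds 0 < Q′_kG′_k²Q′_k^* …, and they imply the
existence of the inverse operator"*; the inverse kernel itself is `torusKernel145M_conv_qggq` (§6).
[cite: Balaban1984PropagatorsI, p.25 (paragraph after (1.44))] -/
theorem qggq_definite (n : ℕ) [NeZero n] (hn1 : 1 ≤ n) (a m2 : ℝ) (ha : 0 < a) (hm : 0 ≤ m2) {N : Fin (d + 1) → ℕ}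
    (hN : ∀ i, 1 ≤ N i) (ω : (Fin (d + 1) → ℤ) → ℂ)
    (h0 : ∑ y ∈ box N, ∑ y' ∈ box N, conj (ω y) * qggq n a m2 N y y' * ω y' = 0) :
    ∀ x ∈ box N, ω x = 0 := by
  classical
  have hP := period_pos n hN
  have hnC : ((n : ℂ) ^ (d + 1))⁻¹ ≠ 0 := inv_ne_zero (pow_ne_zero _ (Nat.cast_ne_zero.mpr (NeZero.ne n)))
  rw [gram_qggq, mul_eq_zero] at h0
  have h1 : ∑ z ∈ box (fun i => n * N i), ‖GQ n a m2 N ω z‖ ^ 2 = 0 := by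
    have h := h0.resolve_left hnC
    exact_mod_cast h
  have h2 : ∀ z ∈ box (fun i => n * N i), GQ n a m2 N ω z = 0 := fun z hz => by
    have := (Finset.sum_eq_zero_iff_of_nonneg (fun w _ => sq_nonneg ‖GQ n a m2 N ω w‖)).mp h1 z hz
    exact norm_eq_zero.mp ((pow_eq_zero_iff two_ne_zero).mp this)
  have h3 : GQ n a m2 N ω = fun _ => 0 := by
    funext z
    rw [← (GQ_isPeriodic n a m2 hN ω).wrap_eq z]
    exact h2 _ (wrap_mem_box hP z)
  intro x hx
  rw [← opD_GQ n hn1 a m2 ha hm hN ω hx (fun _ => 0), h3, opD_eq_stencil]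
  simp

/-- **`Q′G′²Q′^*1 = a⁻²·1`: the multiplier at zero momentum is `a⁻²`** (`Δ(0) = 0`, `|u(0)|² = 1`, `E(0) = a`; the
printed upper bound `γ₁ = a⁻²` of p.26 (sentence after (1.45)) is attained at `p′ = 0` — and exceeded elsewhere for large `a`, cell census
G-B5-13 / `B5.printed_gamma1_fails`). [cite: Balaban1984PropagatorsI, p.25 ("≦ a^{−2}"), p.26 ("γ₁ = a^{−2}")] -/
theorem mReg_at_zero {m : ℕ} (n : ℕ) [NeZero n] (a : ℝ) : mReg n a (fun _ : Fin m => (0 : ℂ)) = ((a : ℂ) ^ 2)⁻¹ := by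
  classical
  have hD : DeltaXi n 0 (fun _ : Fin m => (0 : ℂ)) = 0 := by simp [DeltaXi, Sxi]
  have hU : U n (fun _ => (0 : Fin n)) (fun _ : Fin m => (0 : ℂ)) = 1 := by simp [U, uFactor]
  have hE : E n a 0 (fun _ : Fin m => (0 : ℂ)) = a := by
    rw [E, hD, hU]
    simp
  have hN : Ncal n (fun _ : Fin m => (0 : ℂ)) = 1 := by
    rw [Ncal, hU, hD]
    simp
  rw [mReg, hN, hE, one_div]

end

end Literature.MathematicalPhysics.QuantumFieldTheory.Balaban1983to89.B5QGGQ145Torus
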